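import Summits.BirchSwinnertonDyer.BirchSwinnertonDyer.Theorems.CyclotomicUntwistCompanionShapeLaw
import Summits.BirchSwinnertonDyer.BirchSwinnertonDyer.Theorems.CyclotomicUntwistPSLocalThreeStableLineIIstar
import Literature.NumberTheory.EllipticCurves.NonEisensteinPrimeOfSurjective
import HarnessLib

/-!
# Companion anatomy of the principal-series rows: a semistable mod-`3` partner exists only on the
# ORD-side rows `IV*`/`II*`, and it is ordinary/multiplicative at `3` with `a₃ ≡ −c₆(W)/3^{v₃c₆}`
# (route `CyclotomicUntwist`, K1 `PSRankOneLowerHalfAtThree` / K2 supply — O6 lane V10 read on the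
# K1/K2 rows; cell `bsd-wall`, seat `bsd-line-cycu-p2` g5; THEOREMS ONLY)

The P-SHAPE-PARTNER law (`companionShape_of_equivariant`, `companionShapeLawThree_holds`,
`…CompanionShapeLaw.lean`) composed with this seat's g3/g4 local theory of the principal-series rows
(`ClassO6 W 3`, `v₃Δ_min` even: exactly ONE stable line, `PSLocalThreeTorsion.exists_isUniqueStableLineThree_of_psRow`;
ORD-side iff `v₃Δ_min ≥ 10` iff Kodaira `IV*`/`II*`, `shapeOrdSideThree_iff_of_psRow`; ORDM iff
`c₆(W_ℤ)/3^{v₃c₆} ≡ 1 (mod 3)`, `shapeORDMThree_iff_of_psRow_of_ten_le`). PROVED, for `W` on a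
principal-series row and `G` globally minimal with a `Gal(ℚ̄/ℚ)`-equivariant `G[3] ≃+ W[3]` and `9 ∤ N_G`:

* `psRow_shapeOrdSideThree_of_equivariant` — `W` is ORD-side, hence `v₃Δ_min ∈ {10, 12}`
  (Kodaira `IV*` or `II*`): the ET rows `II` (`v = 4`) and `IV` (`v = 6`) carry NO such `G`
  (`not_equivariant_semistable_of_psRow_of_le_six`);
* `psRow_companion_anatomy` — `3 ∤ c₃(G)` (`G` good ordinary or multiplicative at `3`) and
  `c₃(G) ≡ −1 (mod 3)` iff `c₆(W_ℤ)/3^{v₃c₆} ≡ 1 (mod 3)` (else `c₃(G) ≡ +1`);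
* the same under the K1/K2 binders with the census predicate `O5.IsCompanionAtThree W G`
  (`Surj W 3` gives `ρ̄_{W,3}` irreducible, then Brauer–Nesbitt–Chebotarev):
  `psRow_isCompanionAtThree_anatomy`, `not_isCompanionAtThree_of_psRow_of_le_six`,
  `kodaira_of_psRow_of_isCompanionAtThree`.

READING: a congruence / visibility transport toward K1/K2 from a SEMISTABLE seed can only ever
touch the `IV*`/`II*` half of the 416 PS classes, with the seed's `a₃`-sign pinned by `c₆(W)`; on the
`II`/`IV` half no semistable mod-`3` congruence partner exists. Not a reduction of K1/K2.

HONEST FRAMING: helper theorems; nothing about any particular curve is asserted; K1/K2 are neither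
proved nor reduced; BSD is not proved for any curve. References: [Serre1972] §1.11; [Kraus1990]
Théorème (p = 3); [DarmonDiamondTaylor1995] Prop. 2.6(b).
-/

set_option linter.dupNamespace false

noncomputable section

open scoped Classical

namespace Summit.BirchSwinnertonDyer.BirchSwinnertonDyer.Theorems.CompanionShape

open Polynomial WeierstrassCurve Literature.NumberTheory.EllipticCurves
  Literature.NumberTheory.EllipticCurves.Rank1Residual
  Summit.BirchSwinnertonDyer.Rank1Residual.Additive Summit.BirchSwinnertonDyer.Rank1Residual

section Equivariant

variable (W G : WeierstrassCurve ℚ) [W.IsElliptic] [W.IsGloballyMinimal] [G.IsElliptic]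
  [G.IsGloballyMinimal]
  (e : geomTorsion G (3 : ℤ) ≃+ geomTorsion W (3 : ℤ))
  (he : ∀ (σ : Field.absoluteGaloisGroup ℚ) (P : geomTorsion G (3 : ℤ)), e (σ • P) = σ • e P)
  (h9 : ¬ 9 ∣ G.conductorNorm ℤ)

include he h9 in
/-- **A principal-series row with a semistable mod-`3` partner is ORD-side** (`v₃Δ_min ≥ 10`, Kodaira
`IV*`/`II*`): the row has exactly one stable line, which is neither IRR nor SPLIT, and not ET-side by
the P-SHAPE-PARTNER law. [cite: Serre1972, §1.11] [cite: Kraus1990, Théorème (p = 3)] -/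
theorem psRow_shapeOrdSideThree_of_equivariant (hO6 : ClassO6 W 3)
    (hev : Even (padicValInt 3 W.minimalDiscriminantInt)) :
    ShapeOrdSideThree W ∧ 10 ≤ padicValInt 3 W.minimalDiscriminantInt := by
  have h1 := PSLocalThreeTorsion.exists_isUniqueStableLineThree_of_psRow W hO6 hev
  obtain ⟨x₀, hx⟩ := h1
  obtain ⟨hnotEt, -, -, -⟩ := companionShape_of_equivariant W G e he h9
  have hF : ∀ x₁ : ℚ_[3], IsUniqueStableLineThree W x₁ → stableLineSignThree W x₁ ≠ 0 :=
    fun x₁ hx₁ ↦ (valuation_stableLineSignThree W hx₁).1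
  have hord : ShapeOrdSideThree W := by
    rcases shape_exhaustive W hF with h | h | h | h | h | h
    · exact (h x₀ hx.1).elim
    · obtain ⟨r, r', hne, hr, hr'⟩ := h
      exact (hne ((hx.2 r hr).trans (hx.2 r' hr').symm)).elim
    · exact (hnotEt (Or.inl h)).elim
    · exact (hnotEt (Or.inr h)).elim
    · exact Or.inl h
    · exact Or.inr h
  exact ⟨hord, ((PSLocalThreeTorsion.shapeOrdSideThree_iff_of_psRow W hO6 hev ⟨x₀, hx⟩).1).mp hord⟩

include he h9 in
/-- **The ET rows `II`/`IV` (`v₃Δ_min ≤ 6`) carry no semistable mod-`3` partner.**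
[cite: Serre1972, §1.11] [cite: Kraus1990, Théorème (p = 3)] -/
theorem not_equivariant_semistable_of_psRow_of_le_six (hO6 : ClassO6 W 3)
    (hev : Even (padicValInt 3 W.minimalDiscriminantInt))
    (h6 : padicValInt 3 W.minimalDiscriminantInt ≤ 6) : False := by
  have := (psRow_shapeOrdSideThree_of_equivariant W G e he h9 hO6 hev).2
  omega

include he h9 in
/-- **Companion anatomy on a principal-series row.** `W` is ORD-side with `v₃Δ_min ≥ 10`; the partner
`G` is good-ordinary or multiplicative at `3` (`3 ∤ c₃(G)`); and `c₃(G) ≡ −1 (mod 3)` iff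
`c₆(W_ℤ)/3^{v₃c₆} ≡ 1 (mod 3)` (ORDM: non-anomalous / non-split partner), else `c₃(G) ≡ +1` (ORD1:
anomalous / split partner). [cite: Serre1972, §1.11 Prop. 11] [cite: Kraus1990, Théorème (p = 3)] -/
theorem psRow_companion_anatomy (hO6 : ClassO6 W 3)
    (hev : Even (padicValInt 3 W.minimalDiscriminantInt)) :
    10 ≤ padicValInt 3 W.minimalDiscriminantInt ∧ ¬ (3 : ℤ) ∣ G.LFunction 3 ∧
      (((G.LFunction 3 : ℤ) : ZMod 3) = -1 ↔
        (integralModelInt W).c₆ / 3 ^ padicValInt 3 (integralModelInt W).c₆ % 3 = 1) ∧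
      (((G.LFunction 3 : ℤ) : ZMod 3) = 1 ↔
        ¬ (integralModelInt W).c₆ / 3 ^ padicValInt 3 (integralModelInt W).c₆ % 3 = 1) := by
  obtain ⟨hord, h10⟩ := psRow_shapeOrdSideThree_of_equivariant W G e he h9 hO6 hev
  obtain ⟨-, hirrIff, hord1, hordm⟩ := companionShape_of_equivariant W G e he h9
  obtain ⟨x₀, hx⟩ := PSLocalThreeTorsion.exists_isUniqueStableLineThree_of_psRow W hO6 hev
  have hODM := (PSLocalThreeTorsion.shapeORDMThree_iff_of_psRow_of_ten_le W hO6 hev h10).2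
  have hnotIrr : ¬ ShapeIrrThree W := fun h ↦ h x₀ hx.1
  have hne : ((G.LFunction 3 : ℤ) : ZMod 3) ≠ 0 := fun h ↦ hnotIrr (hirrIff.mpr h)
  have key : ∀ c : ZMod 3, c ≠ 0 → (c = -1 ↔ ¬ c = 1) := by decide
  -- `c₃ ≡ −1` iff ORDM
  have hm1 : ((G.LFunction 3 : ℤ) : ZMod 3) = -1 ↔ ShapeORDMThree W := by
    refine ⟨fun h ↦ ?_, hordm⟩
    rcases hord with h1 | h1
    · have := hord1 h1
      exact (((key _ hne).mp h) this).elim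
    · exact h1
  refine ⟨h10, fun h3 ↦ hne ((ZMod.intCast_zmod_eq_zero_iff_dvd _ 3).mpr h3), hm1.trans hODM, ?_⟩
  rw [← hODM, ← hm1, key _ hne, not_not]

end Equivariant

/-! ## Under the K1/K2 binders: `Surj W 3` and the census companion predicate -/

section Companion

variable (W G : WeierstrassCurve ℚ) [W.IsElliptic] [W.IsGloballyMinimal] [G.IsElliptic]
  [G.IsGloballyMinimal]

omit [W.IsGloballyMinimal] in
/-- `ρ̄_{W,3}` onto ⟹ irreducible (the tree's `hasIrreducibleModPGaloisRep_of_hasSurjectiveModNGaloisRep`).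
[cite: Serre1972, §4] -/
theorem irr_three_of_surj (hsurj : Surj W 3) : W.HasIrreducibleModPGaloisRep 3 :=
  hasIrreducibleModPGaloisRep_of_hasSurjectiveModNGaloisRep W 3 hsurj

/-- **On the K1/K2 rows** (`ClassO6 W 3`, `ρ̄_{W,3}` onto, `v₃Δ_min` even) **a semistable companion
`O5.IsCompanionAtThree W G` forces `v₃Δ_min ≥ 10`, `3 ∤ c₃(G)`, and `c₃(G) ≡ −1 (mod 3)` iff
`c₆(W_ℤ)/3^{v₃c₆} ≡ 1 (mod 3)`.** [cite: DarmonDiamondTaylor1995, Prop. 2.6 (b) (PDF p. 53)]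
[cite: Serre1972, §1.11 Prop. 11] -/
theorem psRow_isCompanionAtThree_anatomy (hO6 : ClassO6 W 3) (hsurj : Surj W 3)
    (hev : Even (padicValInt 3 W.minimalDiscriminantInt)) (hcomp : O5.IsCompanionAtThree W G) :
    10 ≤ padicValInt 3 W.minimalDiscriminantInt ∧ ¬ (3 : ℤ) ∣ G.LFunction 3 ∧
      (((G.LFunction 3 : ℤ) : ZMod 3) = -1 ↔
        (integralModelInt W).c₆ / 3 ^ padicValInt 3 (integralModelInt W).c₆ % 3 = 1) ∧
      (((G.LFunction 3 : ℤ) : ZMod 3) = 1 ↔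
        ¬ (integralModelInt W).c₆ / 3 ^ padicValInt 3 (integralModelInt W).c₆ % 3 = 1) := by
  obtain ⟨e, he⟩ := O5.modThreeTransport_of_isCompanionAtThree W G (irr_three_of_surj W hsurj) hcomp
  exact psRow_companion_anatomy W G e he hcomp.1 hO6 hev

/-- **No semistable companion on the ET half of the PS rows** (`v₃Δ_min ∈ {4, 6}`, Kodaira `II`/`IV`).
[cite: DarmonDiamondTaylor1995, Prop. 2.6 (b) (PDF p. 53)] [cite: Serre1972, §1.11] -/
theorem not_isCompanionAtThree_of_psRow_of_le_six (hO6 : ClassO6 W 3) (hsurj : Surj W 3)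
    (hev : Even (padicValInt 3 W.minimalDiscriminantInt))
    (h6 : padicValInt 3 W.minimalDiscriminantInt ≤ 6) : ¬ O5.IsCompanionAtThree W G := by
  intro hcomp
  obtain ⟨e, he⟩ := O5.modThreeTransport_of_isCompanionAtThree W G (irr_three_of_surj W hsurj) hcomp
  exact not_equivariant_semistable_of_psRow_of_le_six W G e he hcomp.1 hO6 hev h6

/-- **Kodaira form**: a PS row with a semistable companion has Kodaira symbol `IV*` (`v₃Δ_min = 10`)
or `II*` (`v₃Δ_min = 12`) at `3`. [cite: Kraus1990, Théorème (p = 3)] -/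
theorem kodaira_of_psRow_of_isCompanionAtThree (hO6 : ClassO6 W 3) (hsurj : Surj W 3)
    (hev : Even (padicValInt 3 W.minimalDiscriminantInt)) (hcomp : O5.IsCompanionAtThree W G) :
    W.kodairaSymbolAt (placeOf 3) = .IVstar ∨ W.kodairaSymbolAt (placeOf 3) = .IIstar := by
  have h10 := (psRow_isCompanionAtThree_anatomy W G hO6 hsurj hev hcomp).1
  obtain ⟨-, hadd, hW⟩ := hO6
  rcases PSKodairaDictionary.kodairaSymbolAt_of_even W hadd hW hev with
    ⟨-, h⟩ | ⟨-, h⟩ | ⟨hK, -⟩ | ⟨hK, -⟩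
  · omega
  · omega
  · exact Or.inl hK
  · exact Or.inr hK

end Companion

end Summit.BirchSwinnertonDyer.BirchSwinnertonDyer.Theorems.CompanionShape

end
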